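import Summits.CriticalPhenomena.PercolationContinuityZ3.Theorems.SahiMasterFamilyFCrossInduction
import Summits.CriticalPhenomena.PercolationContinuityZ3.Theorems.SahiMasterFamilyFInequalityFreeCoordinates

/-!
# The `F`-inequality: the cross step when the split coordinate is EXTREMAL FOR THE FIRST EVENT; closure of the first argument under
# `x_e ∧ ·` and `x_e ∨ ·`; `F ≥ 0` for every "caterpillar" read-once FIRST event (all cylinders, all ORs of coordinates, …) and ALL increasing `B, G`

Unit `prim-master-conj` (crux anchor stmt-CriticalPhenomena-4575, helper work), gen 22; memo
`run/shared/lean/prim/prim-l12/prim-master-conj/POINTWISE.md` §23.  Companion of prim-bnk-2's `…FCrossInduction` / `…FCrossClosure`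
(one-coordinate Bernstein form `F = (1−t)²F⁰ + t²F¹ + t(1−t)·X_e`, closure of the THIRD argument under `x_e ∨ ·`, `x_e ∧ ·`) and of gen 21/22's
`…FInequalityFreeCoordinates` / `…FInequalityJunta`.

Recall `F(A,B;G) := (1 + μG)·μ(A∩B∩G) − μG·μ(A∩B) − μ(A∩G)·μ(B∩G)` (conjectured `≥ 0` for increasing `A, B, G`; product measure), and the cross
coefficient `X_e` of `SahiFInduction.F_bernstein_secAt`.  This file settles the cross step along a coordinate `e` that is EXTREMAL for `A`:
* `cross_ge_fOne_of_secAt_false_first_empty` — if `A ⊆ {e ∈ ω}` (i.e. `A^{e←0} = ∅`) then **`X_e ≥ F(A¹,B¹;G¹)`** (increasing `B, G`; two monotonicities,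
  no induction hypothesis); hence `fIneq_ge_mul_of_secAt_false_first_empty`: **`F(A,B;G) ≥ p_e·F(A¹,B¹;G¹)`**.
* `cross_ge_fZero_add_fOne_of_secAt_true_first_univ` — if `{e} ∈ A` (i.e. `A^{e←1} = univ`) then **`X_e ≥ F(A⁰,B⁰;G⁰) + F(A¹,B¹;G¹)`**
  (exact identity `X_e − F⁰ − F¹ = −Δg·μ(A⁰B⁰∖G⁰) + Δg·μ(B¹∖G¹) + (μG¹ − μ(A⁰G⁰))·(μ(B¹G¹) − μ(B⁰G⁰))` and `A⁰B⁰∖G⁰ ⊆ (B¹∖G¹) ∪ (B¹G¹∖B⁰G⁰)`,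
  `μ(A⁰G⁰) ≤ μG⁰`); hence `fIneq_ge_of_secAt_true_first_univ`: **`F(A,B;G) ≥ (1−p_e)·F(A⁰,B⁰;G⁰) + p_e·F(univ,B¹;G¹)`** and `F(univ,B;G) = Cov(B,G) ≥ 0`.
* CLOSURE OF THE FIRST ARGUMENT: `fIneq_nonneg_forall_of_first_subset_coord` (`A ⊆ x_e`: `F(A¹,·,·) ≥ 0` for all increasing pairs ⟹ `F(A,·,·) ≥ 0`
  for all increasing pairs) and `fIneq_nonneg_forall_of_coord_mem_first` (`{e} ∈ A`: `F(A⁰,·,·) ≥ 0` for all pairs ⟹ `F(A,·,·) ≥ 0` for all pairs).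
* KERNEL CLASSES (all increasing `B, G`, any dimension, every product measure): `fIneq_nonneg_of_first_univ`, `fIneq_nonneg_of_first_coordinate`
  (`A = x_e`), **`fIneq_nonneg_of_first_cylinder`** (`A = {ω ⊇ S}`, any finset `S` — "first member principal"), **`fIneq_nonneg_of_first_orCoords`**
  (`A = ⋃_{e∈S} x_e`); by iterating the two closure theorems every first event built from `univ` by `x_e ∧ ·` / `x_e ∨ ·` (caterpillar read-once) is
  covered.  By the symmetry `fIneq_comm` the same holds for the SECOND argument (`fIneq_nonneg_of_second_cylinder`, `…_second_orCoords`).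
So after this file the cross step `X_e ≥ 0` is settled whenever `e` is extremal for ONE of the three events (`A` or `B` here; `G` in `…FCrossClosure`);
the open core of prim-bnk-2's induction (`F_nonneg_of_cross_step_AB`) is the split along a coordinate that is pivotal but not extremal for `A` and `B`.
HONEST FRAMING: elementary; `F ≥ 0` in general remains OPEN. [this work]
-/

noncomputable section

open scoped Classical

namespace Summit.CriticalPhenomena.PercolationContinuityZ3.Theorems

open Finset Function
open Literature.Combinatorics.Sahi2008
open Literature.Probability.Percolation.DecisionTree (ind)

namespace Pointwise

variable {ι : Type} [Fintype ι]

local notation3 (prettyPrint := false) "μ⟦" p ", " X "⟧" => ex (bernoulliWeight p) (ind X)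

/-! ### 0. Plumbing -/

/-- Monotonicity of the product-weight probability. [folklore] -/
theorem ex_ind_le_of_subset (p : ι → unitInterval) {X Y : Set (Set ι)} (h : X ⊆ Y) : μ⟦p, X⟧ ≤ μ⟦p, Y⟧ := by
  have h1 := ex_ind_sub_of_subset (bernoulliWeight p) h
  have h2 := ex_ind_nonneg' p (Y \ X)
  linarith

/-- `F` is symmetric in its first two arguments. [this work] -/
theorem fIneq_comm (p : ι → unitInterval) (A B G : Set (Set ι)) :
    (1 + μ⟦p, G⟧) * μ⟦p, A ∩ B ∩ G⟧ - μ⟦p, G⟧ * μ⟦p, A ∩ B⟧ - μ⟦p, A ∩ G⟧ * μ⟦p, B ∩ G⟧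
      = (1 + μ⟦p, G⟧) * μ⟦p, B ∩ A ∩ G⟧ - μ⟦p, G⟧ * μ⟦p, B ∩ A⟧ - μ⟦p, B ∩ G⟧ * μ⟦p, A ∩ G⟧ := by
  rw [Set.inter_comm B A]; ring

/-- `F(univ,B;G) = Cov(B,G) ≥ 0` for increasing `B, G` (Harris). [this work] -/
theorem fIneq_nonneg_of_first_univ (p : ι → unitInterval) {B G : Set (Set ι)} (hB : IsUpperSet B) (hG : IsUpperSet G) :
    0 ≤ (1 + μ⟦p, G⟧) * μ⟦p, Set.univ ∩ B ∩ G⟧ - μ⟦p, G⟧ * μ⟦p, Set.univ ∩ B⟧ - μ⟦p, Set.univ ∩ G⟧ * μ⟦p, B ∩ G⟧ := by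
  simp only [Set.univ_inter]
  have h := cov_ind_nonneg p hB hG
  nlinarith [h]

/-- `F(∅,B;G) = 0`. [this work] -/
theorem fIneq_first_empty (p : ι → unitInterval) (B G : Set (Set ι)) :
    (1 + μ⟦p, G⟧) * μ⟦p, ∅ ∩ B ∩ G⟧ - μ⟦p, G⟧ * μ⟦p, ∅ ∩ B⟧ - μ⟦p, ∅ ∩ G⟧ * μ⟦p, B ∩ G⟧ = 0 := by
  simp only [Set.empty_inter, ex_ind_empty]; ring

/-! ### 1. The cross step when `A ⊆ {e ∈ ω}` -/

section FirstBelow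

variable (p : ι → unitInterval) (e : ι) {A B G : Set (Set ι)} (hB : IsUpperSet B) (hG : IsUpperSet G) (hA0 : secAt e false A = ∅)
include hB hG hA0

/-- **`A ⊆ x_e` ⟹ `X_e ≥ F(A¹,B¹;G¹)`.**  With `A⁰ = ∅` the cross coefficient is `μ(V¹) + μG⁰·μ(V¹) − μG⁰·μ(A¹B¹) − μ(A¹G¹)·μ(B⁰G⁰)`
(`V¹ = A¹B¹G¹`), and `μG⁰ ≤ μG¹`, `μ(B⁰G⁰) ≤ μ(B¹G¹)`, `μ(V¹) ≤ μ(A¹B¹)`. [this work] -/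
theorem cross_ge_fOne_of_secAt_false_first_empty :
    (1 + μ⟦p, secAt e true G⟧) * μ⟦p, secAt e true A ∩ secAt e true B ∩ secAt e true G⟧
        - μ⟦p, secAt e true G⟧ * μ⟦p, secAt e true A ∩ secAt e true B⟧
        - μ⟦p, secAt e true A ∩ secAt e true G⟧ * μ⟦p, secAt e true B ∩ secAt e true G⟧
      ≤ μ⟦p, secAt e true A ∩ secAt e true B ∩ secAt e true G⟧ + μ⟦p, secAt e false A ∩ secAt e false B ∩ secAt e false G⟧
        + μ⟦p, secAt e true G⟧ * μ⟦p, secAt e false A ∩ secAt e false B ∩ secAt e false G⟧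
        + μ⟦p, secAt e false G⟧ * μ⟦p, secAt e true A ∩ secAt e true B ∩ secAt e true G⟧
        - μ⟦p, secAt e true G⟧ * μ⟦p, secAt e false A ∩ secAt e false B⟧
        - μ⟦p, secAt e false G⟧ * μ⟦p, secAt e true A ∩ secAt e true B⟧
        - μ⟦p, secAt e true A ∩ secAt e true G⟧ * μ⟦p, secAt e false B ∩ secAt e false G⟧
        - μ⟦p, secAt e false A ∩ secAt e false G⟧ * μ⟦p, secAt e true B ∩ secAt e true G⟧ := by
  rw [hA0]
  simp only [Set.empty_inter, ex_ind_empty, mul_zero, zero_mul, add_zero, sub_zero]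
  have hg : μ⟦p, secAt e false G⟧ ≤ μ⟦p, secAt e true G⟧ :=
    ex_ind_le_of_subset p (RigidityAll.secAt_false_subset_secAt_true e hG)
  have hg0 : 0 ≤ μ⟦p, secAt e false G⟧ := ex_ind_nonneg' p _
  have hb : μ⟦p, secAt e false B ∩ secAt e false G⟧ ≤ μ⟦p, secAt e true B ∩ secAt e true G⟧ :=
    ex_ind_le_of_subset p (Set.inter_subset_inter (RigidityAll.secAt_false_subset_secAt_true e hB)
      (RigidityAll.secAt_false_subset_secAt_true e hG))
  have hv : μ⟦p, secAt e true A ∩ secAt e true B ∩ secAt e true G⟧ ≤ μ⟦p, secAt e true A ∩ secAt e true B⟧ :=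
    ex_ind_le_of_subset p Set.inter_subset_left
  have ha : 0 ≤ μ⟦p, secAt e true A ∩ secAt e true G⟧ := ex_ind_nonneg' p _
  nlinarith [mul_le_mul_of_nonneg_left hb ha, mul_le_mul_of_nonneg_right hg (sub_nonneg.2 hv)]

/-- **`A ⊆ x_e` ⟹ `F(A,B;G) ≥ p_e · F(A¹,B¹;G¹)`** (Bernstein form: `F⁰ = F(∅,·,·) = 0`, `X_e ≥ F¹`, and `t² + t(1−t) = t`). [this work] -/
theorem fIneq_ge_mul_of_secAt_false_first_empty :
    (p e : ℝ) * ((1 + μ⟦p, secAt e true G⟧) * μ⟦p, secAt e true A ∩ secAt e true B ∩ secAt e true G⟧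
        - μ⟦p, secAt e true G⟧ * μ⟦p, secAt e true A ∩ secAt e true B⟧
        - μ⟦p, secAt e true A ∩ secAt e true G⟧ * μ⟦p, secAt e true B ∩ secAt e true G⟧)
      ≤ (1 + μ⟦p, G⟧) * μ⟦p, A ∩ B ∩ G⟧ - μ⟦p, G⟧ * μ⟦p, A ∩ B⟧ - μ⟦p, A ∩ G⟧ * μ⟦p, B ∩ G⟧ := by
  have hX := cross_ge_fOne_of_secAt_false_first_empty p e hB hG hA0
  rw [SahiFInduction.F_bernstein_secAt p e A B G]
  have h0 : (1 + μ⟦p, secAt e false G⟧) * μ⟦p, secAt e false A ∩ secAt e false B ∩ secAt e false G⟧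
        - μ⟦p, secAt e false G⟧ * μ⟦p, secAt e false A ∩ secAt e false B⟧
        - μ⟦p, secAt e false A ∩ secAt e false G⟧ * μ⟦p, secAt e false B ∩ secAt e false G⟧ = 0 := by
    rw [hA0]; exact fIneq_first_empty p _ _
  rw [h0, mul_zero, zero_add]
  have ht0 : 0 ≤ (p e : ℝ) := (p e).2.1
  have ht1 : 0 ≤ 1 - (p e : ℝ) := sub_nonneg.2 (p e).2.2
  have key := mul_le_mul_of_nonneg_left hX (mul_nonneg ht0 ht1)
  nlinarith [key]

end FirstBelow

/-! ### 2. The cross step when `{e} ∈ A` -/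

section FirstAbove

variable (p : ι → unitInterval) (e : ι) {A B G : Set (Set ι)} (hB : IsUpperSet B) (hG : IsUpperSet G)
  (hA1 : secAt e true A = Set.univ)
include hB hG hA1

/-- **`{e} ∈ A` ⟹ `X_e ≥ F(A⁰,B⁰;G⁰) + F(A¹,B¹;G¹)`.**  With `A¹ = univ`:
`X_e − F⁰ − F¹ = −Δg·[μ(A⁰B⁰) − μ(A⁰B⁰G⁰)] + Δg·[μB¹ − μ(B¹G¹)] + (μG¹ − μ(A⁰G⁰))·(μ(B¹G¹) − μ(B⁰G⁰))` (`Δg = μG¹ − μG⁰ ≥ 0`), and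
`μ(A⁰B⁰) − μ(A⁰B⁰G⁰) ≤ μB⁰ − μ(B⁰G⁰) ≤ [μB¹ − μ(B¹G¹)] + [μ(B¹G¹) − μ(B⁰G⁰)]`, `Δg ≤ μG¹ − μ(A⁰G⁰)`. [this work] -/
theorem cross_ge_fZero_add_fOne_of_secAt_true_first_univ :
    ((1 + μ⟦p, secAt e false G⟧) * μ⟦p, secAt e false A ∩ secAt e false B ∩ secAt e false G⟧
        - μ⟦p, secAt e false G⟧ * μ⟦p, secAt e false A ∩ secAt e false B⟧
        - μ⟦p, secAt e false A ∩ secAt e false G⟧ * μ⟦p, secAt e false B ∩ secAt e false G⟧)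
      + ((1 + μ⟦p, secAt e true G⟧) * μ⟦p, secAt e true A ∩ secAt e true B ∩ secAt e true G⟧
        - μ⟦p, secAt e true G⟧ * μ⟦p, secAt e true A ∩ secAt e true B⟧
        - μ⟦p, secAt e true A ∩ secAt e true G⟧ * μ⟦p, secAt e true B ∩ secAt e true G⟧)
      ≤ μ⟦p, secAt e true A ∩ secAt e true B ∩ secAt e true G⟧ + μ⟦p, secAt e false A ∩ secAt e false B ∩ secAt e false G⟧
        + μ⟦p, secAt e true G⟧ * μ⟦p, secAt e false A ∩ secAt e false B ∩ secAt e false G⟧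
        + μ⟦p, secAt e false G⟧ * μ⟦p, secAt e true A ∩ secAt e true B ∩ secAt e true G⟧
        - μ⟦p, secAt e true G⟧ * μ⟦p, secAt e false A ∩ secAt e false B⟧
        - μ⟦p, secAt e false G⟧ * μ⟦p, secAt e true A ∩ secAt e true B⟧
        - μ⟦p, secAt e true A ∩ secAt e true G⟧ * μ⟦p, secAt e false B ∩ secAt e false G⟧
        - μ⟦p, secAt e false A ∩ secAt e false G⟧ * μ⟦p, secAt e true B ∩ secAt e true G⟧ := by
  rw [hA1]
  simp only [Set.univ_inter]
  set g0 := μ⟦p, secAt e false G⟧ with hg0d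
  set g1 := μ⟦p, secAt e true G⟧ with hg1d
  set a0 := μ⟦p, secAt e false A ∩ secAt e false G⟧
  set v0 := μ⟦p, secAt e false A ∩ secAt e false B ∩ secAt e false G⟧
  set m0' := μ⟦p, secAt e false A ∩ secAt e false B⟧
  set b0 := μ⟦p, secAt e false B ∩ secAt e false G⟧
  set d1 := μ⟦p, secAt e true B ∩ secAt e true G⟧
  set nB1 := μ⟦p, secAt e true B⟧
  -- monotonicities
  have hg : g0 ≤ g1 := ex_ind_le_of_subset p (RigidityAll.secAt_false_subset_secAt_true e hG)
  have hag : a0 ≤ g0 := ex_ind_le_of_subset p Set.inter_subset_right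
  have hbd : b0 ≤ d1 :=
    ex_ind_le_of_subset p (Set.inter_subset_inter (RigidityAll.secAt_false_subset_secAt_true e hB)
      (RigidityAll.secAt_false_subset_secAt_true e hG))
  have hdB : d1 ≤ nB1 := ex_ind_le_of_subset p Set.inter_subset_left
  -- `μ(A⁰B⁰) − μ(A⁰B⁰G⁰) ≤ μB⁰ − μ(B⁰G⁰) ≤ μB¹ − μ(B⁰G⁰)`
  have hm : m0' - v0 ≤ nB1 - b0 := by
    have h1 : m0' - v0 = μ⟦p, (secAt e false A ∩ secAt e false B) \ (secAt e false A ∩ secAt e false B ∩ secAt e false G)⟧ :=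
      ex_ind_sub_of_subset (bernoulliWeight p) Set.inter_subset_left
    have h2 : nB1 - b0 = μ⟦p, secAt e true B \ (secAt e false B ∩ secAt e false G)⟧ :=
      ex_ind_sub_of_subset (bernoulliWeight p)
        ((Set.inter_subset_left).trans (RigidityAll.secAt_false_subset_secAt_true e hB))
    rw [h1, h2]
    refine ex_ind_le_of_subset p ?_
    rintro ω ⟨⟨hωA, hωB⟩, hωV⟩
    refine ⟨RigidityAll.secAt_false_subset_secAt_true e hB hωB, fun h => hωV ⟨⟨hωA, hωB⟩, h.2⟩⟩
  have hdg : 0 ≤ g1 - g0 := sub_nonneg.2 hg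
  have key1 : (g1 - g0) * (m0' - v0) ≤ (g1 - g0) * (nB1 - b0) := mul_le_mul_of_nonneg_left hm hdg
  have key2 : (g1 - g0) * (d1 - b0) ≤ (g1 - a0) * (d1 - b0) :=
    mul_le_mul_of_nonneg_right (by linarith) (sub_nonneg.2 hbd)
  nlinarith [key1, key2]

/-- **`{e} ∈ A` ⟹ `F(A,B;G) ≥ (1−p_e)·F(A⁰,B⁰;G⁰) + p_e·F(A¹,B¹;G¹)`** (Bernstein form + the previous lemma:
`(1−t)²F⁰ + t²F¹ + t(1−t)(F⁰+F¹) = (1−t)F⁰ + tF¹`). [this work] -/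
theorem fIneq_ge_of_secAt_true_first_univ :
    (1 - (p e : ℝ)) * ((1 + μ⟦p, secAt e false G⟧) * μ⟦p, secAt e false A ∩ secAt e false B ∩ secAt e false G⟧
        - μ⟦p, secAt e false G⟧ * μ⟦p, secAt e false A ∩ secAt e false B⟧
        - μ⟦p, secAt e false A ∩ secAt e false G⟧ * μ⟦p, secAt e false B ∩ secAt e false G⟧)
      + (p e : ℝ) * ((1 + μ⟦p, secAt e true G⟧) * μ⟦p, secAt e true A ∩ secAt e true B ∩ secAt e true G⟧
        - μ⟦p, secAt e true G⟧ * μ⟦p, secAt e true A ∩ secAt e true B⟧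
        - μ⟦p, secAt e true A ∩ secAt e true G⟧ * μ⟦p, secAt e true B ∩ secAt e true G⟧)
      ≤ (1 + μ⟦p, G⟧) * μ⟦p, A ∩ B ∩ G⟧ - μ⟦p, G⟧ * μ⟦p, A ∩ B⟧ - μ⟦p, A ∩ G⟧ * μ⟦p, B ∩ G⟧ := by
  have hX := cross_ge_fZero_add_fOne_of_secAt_true_first_univ p e hB hG hA1
  rw [SahiFInduction.F_bernstein_secAt p e A B G]
  have ht0 : 0 ≤ (p e : ℝ) := (p e).2.1
  have ht1 : 0 ≤ 1 - (p e : ℝ) := sub_nonneg.2 (p e).2.2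
  have key := mul_le_mul_of_nonneg_left hX (mul_nonneg ht0 ht1)
  nlinarith [key]

end FirstAbove

/-! ### 3. Closure of the first argument; kernel classes -/

/-- **Closure under `x_e ∧ ·` in the first argument**: if `A ⊆ {e ∈ ω}` and `F(A¹,B',G') ≥ 0` for all increasing `B', G'`, then `F(A,B,G) ≥ 0` for
all increasing `B, G`. [this work] -/
theorem fIneq_nonneg_forall_of_first_subset_coord (p : ι → unitInterval) (e : ι) {A : Set (Set ι)} (hA0 : secAt e false A = ∅)
    (h1 : ∀ B' G' : Set (Set ι), IsUpperSet B' → IsUpperSet G' →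
      0 ≤ (1 + μ⟦p, G'⟧) * μ⟦p, secAt e true A ∩ B' ∩ G'⟧ - μ⟦p, G'⟧ * μ⟦p, secAt e true A ∩ B'⟧ - μ⟦p, secAt e true A ∩ G'⟧ * μ⟦p, B' ∩ G'⟧)
    {B G : Set (Set ι)} (hB : IsUpperSet B) (hG : IsUpperSet G) :
    0 ≤ (1 + μ⟦p, G⟧) * μ⟦p, A ∩ B ∩ G⟧ - μ⟦p, G⟧ * μ⟦p, A ∩ B⟧ - μ⟦p, A ∩ G⟧ * μ⟦p, B ∩ G⟧ := by
  have h := fIneq_ge_mul_of_secAt_false_first_empty p e hB hG hA0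
  have hF1 := h1 (secAt e true B) (secAt e true G) (isUpperSet_secAt e true hB) (isUpperSet_secAt e true hG)
  have ht0 : 0 ≤ (p e : ℝ) := (p e).2.1
  nlinarith [mul_nonneg ht0 hF1]

/-- **Closure under `x_e ∨ ·` in the first argument**: if `{e} ∈ A` (so `A^{e←1} = univ`) and `F(A⁰,B',G') ≥ 0` for all increasing `B', G'`, then
`F(A,B,G) ≥ 0` for all increasing `B, G`. [this work] -/
theorem fIneq_nonneg_forall_of_coord_mem_first (p : ι → unitInterval) (e : ι) {A : Set (Set ι)}
    (hA1 : secAt e true A = Set.univ)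
    (h0 : ∀ B' G' : Set (Set ι), IsUpperSet B' → IsUpperSet G' →
      0 ≤ (1 + μ⟦p, G'⟧) * μ⟦p, secAt e false A ∩ B' ∩ G'⟧ - μ⟦p, G'⟧ * μ⟦p, secAt e false A ∩ B'⟧
        - μ⟦p, secAt e false A ∩ G'⟧ * μ⟦p, B' ∩ G'⟧)
    {B G : Set (Set ι)} (hB : IsUpperSet B) (hG : IsUpperSet G) :
    0 ≤ (1 + μ⟦p, G⟧) * μ⟦p, A ∩ B ∩ G⟧ - μ⟦p, G⟧ * μ⟦p, A ∩ B⟧ - μ⟦p, A ∩ G⟧ * μ⟦p, B ∩ G⟧ := by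
  have h := fIneq_ge_of_secAt_true_first_univ p e hB hG hA1
  have hF0 := h0 (secAt e false B) (secAt e false G) (isUpperSet_secAt e false hB) (isUpperSet_secAt e false hG)
  have hF1 : 0 ≤ (1 + μ⟦p, secAt e true G⟧) * μ⟦p, secAt e true A ∩ secAt e true B ∩ secAt e true G⟧
        - μ⟦p, secAt e true G⟧ * μ⟦p, secAt e true A ∩ secAt e true B⟧
        - μ⟦p, secAt e true A ∩ secAt e true G⟧ * μ⟦p, secAt e true B ∩ secAt e true G⟧ := by
    rw [hA1]; exact fIneq_nonneg_of_first_univ p (isUpperSet_secAt e true hB) (isUpperSet_secAt e true hG)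
  have ht0 : 0 ≤ (p e : ℝ) := (p e).2.1
  have ht1 : 0 ≤ 1 - (p e : ℝ) := sub_nonneg.2 (p e).2.2
  nlinarith [mul_nonneg ht1 hF0, mul_nonneg ht0 hF1]

/-- **`F(x_e,B;G) ≥ 0` for all increasing `B, G`** (first member a single coordinate). [this work] -/
theorem fIneq_nonneg_of_first_coordinate (p : ι → unitInterval) (e : ι) {B G : Set (Set ι)} (hB : IsUpperSet B) (hG : IsUpperSet G) :
    0 ≤ (1 + μ⟦p, G⟧) * μ⟦p, {ω : Set ι | e ∈ ω} ∩ B ∩ G⟧ - μ⟦p, G⟧ * μ⟦p, {ω : Set ι | e ∈ ω} ∩ B⟧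
        - μ⟦p, {ω : Set ι | e ∈ ω} ∩ G⟧ * μ⟦p, B ∩ G⟧ := by
  refine fIneq_nonneg_forall_of_first_subset_coord p e (SahiCombDisjunct.secAt_false_coord e) (fun B' G' hB' hG' => ?_) hB hG
  rw [SahiCombDisjunct.secAt_true_coord e]
  exact fIneq_nonneg_of_first_univ p hB' hG'

omit [Fintype ι] in
/-- Sections of a cylinder `{ω | S ⊆ ω}` at a coordinate `e ∉ S`... and at `e` with `S' = insert e S`: the `0`-section of `{ω | insert e S ⊆ ω}` is
empty and its `1`-section is `{ω | S ⊆ ω}` (for `e ∉ S`). [folklore] -/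
theorem secAt_cylinder_insert (e : ι) {S : Finset ι} (he : e ∉ S) :
    secAt e false {ω : Set ι | (↑(insert e S) : Set ι) ⊆ ω} = ∅ ∧
      secAt e true {ω : Set ι | (↑(insert e S) : Set ι) ⊆ ω} = {ω : Set ι | (↑S : Set ι) ⊆ ω} := by
  constructor
  · ext ω
    simp only [mem_secAt, forceAt, cond_false, Set.mem_setOf_eq, Finset.coe_insert, Set.mem_empty_iff_false, iff_false]
    intro h
    have : e ∈ ω \ {e} := h (Set.mem_insert e _)
    exact this.2 rfl
  · ext ω
    simp only [mem_secAt, forceAt, cond_true, Set.mem_setOf_eq, Finset.coe_insert]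
    constructor
    · intro h x hx
      have hx' : x ∈ insert e ω := h (Set.mem_insert_of_mem e (Finset.mem_coe.2 hx))
      rcases Set.mem_insert_iff.1 hx' with rfl | h'
      · exact absurd hx he
      · exact h'
    · intro h
      exact Set.insert_subset_insert h

/-- **`F({ω ⊇ S},B;G) ≥ 0` for every finset `S` and all increasing `B, G`** (first member a cylinder / principal up-set; induction on `S`). [this work] -/
theorem fIneq_nonneg_of_first_cylinder (p : ι → unitInterval) (S : Finset ι) :
    ∀ {B G : Set (Set ι)}, IsUpperSet B → IsUpperSet G →
      0 ≤ (1 + μ⟦p, G⟧) * μ⟦p, {ω : Set ι | (↑S : Set ι) ⊆ ω} ∩ B ∩ G⟧ - μ⟦p, G⟧ * μ⟦p, {ω : Set ι | (↑S : Set ι) ⊆ ω} ∩ B⟧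
          - μ⟦p, {ω : Set ι | (↑S : Set ι) ⊆ ω} ∩ G⟧ * μ⟦p, B ∩ G⟧ := by
  induction S using Finset.induction_on with
  | empty =>
    intro B G hB hG
    have : {ω : Set ι | (↑(∅ : Finset ι) : Set ι) ⊆ ω} = Set.univ := by
      ext ω; simp
    rw [this]; exact fIneq_nonneg_of_first_univ p hB hG
  | insert e S he ih =>
    intro B G hB hG
    obtain ⟨h0, h1⟩ := secAt_cylinder_insert e he
    refine fIneq_nonneg_forall_of_first_subset_coord p e h0 (fun B' G' hB' hG' => ?_) hB hG
    rw [h1]; exact ih hB' hG'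

omit [Fintype ι] in
/-- Sections of the OR of coordinates `⋃_{x ∈ insert e S} x_x` at `e ∉ S`: the `1`-section is `univ`, the `0`-section is `⋃_{x∈S} x_x`. [folklore] -/
theorem secAt_orCoords_insert (e : ι) {S : Finset ι} (he : e ∉ S) :
    secAt e true {ω : Set ι | ∃ x ∈ insert e S, x ∈ ω} = Set.univ ∧
      secAt e false {ω : Set ι | ∃ x ∈ insert e S, x ∈ ω} = {ω : Set ι | ∃ x ∈ S, x ∈ ω} := by
  constructor
  · ext ω
    simp only [mem_secAt, forceAt, cond_true, Set.mem_setOf_eq, Set.mem_univ, iff_true]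
    exact ⟨e, Finset.mem_insert_self e S, Set.mem_insert e ω⟩
  · ext ω
    simp only [mem_secAt, forceAt, cond_false, Set.mem_setOf_eq, Set.mem_sdiff, Set.mem_singleton_iff, Finset.mem_insert]
    constructor
    · rintro ⟨x, hx | hx, hxω, hxe⟩
      · exact absurd hx hxe
      · exact ⟨x, hx, hxω⟩
    · rintro ⟨x, hx, hxω⟩
      exact ⟨x, Or.inr hx, hxω, fun h => he (h ▸ hx)⟩

/-- **`F(⋃_{x∈S} x_x, B; G) ≥ 0` for every finset `S` and all increasing `B, G`** (first member an OR of coordinates; induction on `S`). [this work] -/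
theorem fIneq_nonneg_of_first_orCoords (p : ι → unitInterval) (S : Finset ι) :
    ∀ {B G : Set (Set ι)}, IsUpperSet B → IsUpperSet G →
      0 ≤ (1 + μ⟦p, G⟧) * μ⟦p, {ω : Set ι | ∃ x ∈ S, x ∈ ω} ∩ B ∩ G⟧ - μ⟦p, G⟧ * μ⟦p, {ω : Set ι | ∃ x ∈ S, x ∈ ω} ∩ B⟧
          - μ⟦p, {ω : Set ι | ∃ x ∈ S, x ∈ ω} ∩ G⟧ * μ⟦p, B ∩ G⟧ := by
  induction S using Finset.induction_on with
  | empty =>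
    intro B G hB hG
    have : {ω : Set ι | ∃ x ∈ (∅ : Finset ι), x ∈ ω} = ∅ := by
      ext ω; simp
    rw [this, fIneq_first_empty]
  | insert e S he ih =>
    intro B G hB hG
    obtain ⟨h1, h0⟩ := secAt_orCoords_insert e he
    refine fIneq_nonneg_forall_of_coord_mem_first p e h1 (fun B' G' hB' hG' => ?_) hB hG
    rw [h0]; exact ih hB' hG'

/-! ### 4. The second argument, by symmetry -/

/-- **`F(A,{ω ⊇ S};G) ≥ 0`** for all increasing `A, G` (second member a cylinder). [this work] -/
theorem fIneq_nonneg_of_second_cylinder (p : ι → unitInterval) (S : Finset ι) {A G : Set (Set ι)} (hA : IsUpperSet A)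
    (hG : IsUpperSet G) :
    0 ≤ (1 + μ⟦p, G⟧) * μ⟦p, A ∩ {ω : Set ι | (↑S : Set ι) ⊆ ω} ∩ G⟧ - μ⟦p, G⟧ * μ⟦p, A ∩ {ω : Set ι | (↑S : Set ι) ⊆ ω}⟧
        - μ⟦p, A ∩ G⟧ * μ⟦p, {ω : Set ι | (↑S : Set ι) ⊆ ω} ∩ G⟧ := by
  rw [fIneq_comm]; exact fIneq_nonneg_of_first_cylinder p S hA hG

/-- **`F(A,⋃_{x∈S} x_x;G) ≥ 0`** for all increasing `A, G` (second member an OR of coordinates). [this work] -/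
theorem fIneq_nonneg_of_second_orCoords (p : ι → unitInterval) (S : Finset ι) {A G : Set (Set ι)} (hA : IsUpperSet A)
    (hG : IsUpperSet G) :
    0 ≤ (1 + μ⟦p, G⟧) * μ⟦p, A ∩ {ω : Set ι | ∃ x ∈ S, x ∈ ω} ∩ G⟧ - μ⟦p, G⟧ * μ⟦p, A ∩ {ω : Set ι | ∃ x ∈ S, x ∈ ω}⟧
        - μ⟦p, A ∩ G⟧ * μ⟦p, {ω : Set ι | ∃ x ∈ S, x ∈ ω} ∩ G⟧ := by
  rw [fIneq_comm]; exact fIneq_nonneg_of_first_orCoords p S hA hG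

end Pointwise

end Summit.CriticalPhenomena.PercolationContinuityZ3.Theorems
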